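import Literature.AlgebraicGeometry.Resolution.InseparableLocalUniformizationCurves
import Mathlib.RingTheory.Flat.FaithfullyFlat.Algebra
import Mathlib.RingTheory.Flat.Localization
import Mathlib.RingTheory.Spectrum.Prime.Chevalley
import Mathlib.RingTheory.Smooth.Flat
import HarnessLib

/-!
# Inseparable local uniformization: the lemmas feeding §4 (Temkin 2013, Lemmas 2.8.4, 2.8.5, 3.3.2)

Topic: `Literature/AlgebraicGeometry/Resolution`. M. Temkin, *Inseparable local uniformization*,
J. Algebra 373 (2013) 65–119 = arXiv:0804.1554v3 (all numbers and pages are those of this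
version). The two remaining packaged steps of the proof of the (corrected) Thm. 1.3.2,
`Temkin2013DescentDefectStep` (§4.1, Steps 1–4, `InseparableLocalUniformizationDefect.lean`) and
`Temkin2013HeightStepOfDescent` (§4.2, `InseparableLocalUniformizationDescent.lean`), invoke —
besides Thm. 3.3.1 (`Temkin2013RelativeCurve`, `InseparableLocalUniformizationCurves.lean`) and
Thm. 4.1.1 (`Temkin2013Descent`) — the following printed results, vendored here in the affine
vocabulary of `InseparableLocalUniformizationCurves.lean` (`AreSmoothEquivalent`, Definition
2.8.1; `IsAffineNormalizedModel`, §3.3) so that the §4 arguments themselves can be formalized on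
top of them (the other results cited in §4 — Prop. 2.3.8 (i) "`Cᵢ` is the projective limit of
`X_{i,α}`'s" and Lemma 2.3.9 (iv) — become, in this affine setting, elementary statements about
unions of integral closures inside a field, to be proved with the assembly; Lemma 5.2.3 concerns
only the logarithmic structure, which the vendored non-logarithmic forms drop):

* `Temkin2013_Lemma284` — NAMED FACT, **Lemma 2.8.4**, direction "⇒" (smooth-equivalence over a
  filtered projective limit `S = lim S_α` descends to smooth-equivalence over `S_α` for all large
  `α`), in the affine situation in which §4 uses it (Step 3 of the proof of Thm. 4.1.1, p. 49;
  §4.2, Step 2, p. 51): `S_α = Spec B_α` the affine refinements of an affine base inside a field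
  `κ`, `S = Spec R₀` with `R₀ = ⋃ B_α`, and `η`-normalized base changes of affine models inside
  fields `K ⊇ κ`, `M ⊇ κ` (`etaModel`). Its printed proof rests on Prop. 2.3.8 (`η`-normalized
  filtered limits, after EGA IV₃ §8) and is not reproduced here — DISCHARGED downstream:
  `Temkin2013_Lemma284_holds` (`InseparableLocalUniformizationLemmasProofs.lean`, from Mathlib's
  Noetherian descent of smooth algebras).
* `Temkin2013_Lemma285` — **DEPRECATED** (2026-08-15: `@[deprecated]`, statement kept verbatim as
  the literal record and as the subject of its refutation) MIS-RENDERED NAMED FACT: **Lemma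
  2.8.5** (smooth-equivalence over `S` is preserved when both schemes are replaced by their
  normalizations in a common finite purely inseparable extension `k′` of `k(S)`), affine
  rendering for merely INTEGRAL `X`, `Y` and ALL primes `x′`, `y′` over `x`, `y`. Its printed
  proof rests on Lemma 2.3.9 (ii) (normalization in a field extension of a smooth morphism is
  smooth) and on "the morphisms `X′ → X`, `Y′ → Y` and `Z′ → Z` are bijective", i.e. the printed
  "the preimages `x′`, `y′`" tacitly assumes `X` and `Y` NORMAL (as at every place where §4
  applies it); this rendering, which only assumes them integral, is FALSE:
  `not_temkin2013_Lemma285 : ¬ Temkin2013_Lemma285` (`SmoothEquivalenceNormalization.lean`,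
  counterexample: the affine line with two points glued and the two preimages of the singular
  point in the normalization, `k′ = k(S)`). The corrected rendering `Temkin2013_Lemma285_normal`
  (same file) is PROVED: `Temkin2013_Lemma285_normal_holds`
  (`SmoothEquivalenceNormalizationProofs.lean`). Never take `(h : Temkin2013_Lemma285)` as a
  hypothesis; every use of the name now raises a deprecation warning pointing there.
* `Temkin2013_Lemma332` — **DEPRECATED** (2026-08-15: `@[deprecated]`, statement kept verbatim as
  the literal record and as the subject of its refutation) MIS-RENDERED NAMED FACT: **Lemma
  3.3.2** (the "decompletion" lemma used in §4.2 instead of Thm. 3.3.1: a simple `k`-smooth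
  closed point `x` of the generic fibre of an affine normal nft `S`-scheme `X`, `S = Spec k°` of
  height one, through which a valuation ring `m°` of `m = k(x)` maps, becomes — after an affine
  modification `X′ → X` which is an isomorphism on generic fibres and to which `Spec m° → X`
  lifts — smooth-equivalent over `S` to the closed point of `Spec m°`). Its printed proof is
  Berkovich-analytic ([Ber2, 3.3.6, 3.4.1], Weierstrass domains, Thm. 2.8.2 (ii)); none of this
  is in Mathlib. This rendering OMITS the printed finiteness hypothesis "`X → S` of normalized
  finite presentation" (a partial normalization — inside its own fraction field — of an
  `S`-scheme of finite presentation; given `A = Nr_K(k°[f])`, `Frac A = K`: "`K/k` finitely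
  generated"), so it also quantifies over infinite algebraic `K ⊇ Frac(k°[f])` and is FALSE:
  `not_temkin2013_Lemma332 : ¬ Temkin2013_Lemma332`
  (`InseparableLocalUniformizationDecompletionRefutation.lean`, counterexample: `k = ℚ(X)` with
  the `X`-adic valuation, `K = Frac k[ℚ] = k(t^q : q ∈ ℚ)`, `A = Nr_K(k°[t, t⁻¹])`, `m = k`, `x`
  the augmentation point `t^q ↦ 1`; another, arithmetic, counterexample `k = 𝔽_p(t)`,
  `K = m = kˢᵉᵖ`, `A = Nr_K(k°)` is sketched in the module docstring of
  `InseparableLocalUniformizationDecompletion.lean`). The corrected rendering, with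
  `(⊤ : IntermediateField k K).FG` restored, is `Temkin2013_Lemma332_nft` there (and
  `Temkin2013_Lemma332_nft.of_lemma332`). Never take `(h : Temkin2013_Lemma332)` as a
  hypothesis (every use of the name now raises a deprecation warning pointing there); the §4.2
  reduction has the finiteness (`K/k̄` finitely generated) needed to use the `_nft` form
  (`relConclusion_of_normalForm_nft`, `InseparableLocalUniformizationHeightStepTwo.lean`;
  `relHeightLE_succ_nft`, `InseparableLocalUniformizationHeightInduction.lean`), and the
  corollaries there still taking `(h332 : Temkin2013_Lemma332)` are vacuous records.
* `Stacks05B5` — NAMED FACT, **descent of smoothness through a flat surjective cover of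
  finite presentation** (Stacks Project, Tag 05B5), affine form; this is the step "in particular,
  `x₁` is `l`-smooth" of Step 4 of the proof of Thm. 4.1.1 (p. 49: a point smooth-equivalent to
  an `l`-smooth point is `l`-smooth), i.e. the direction "⇒" of the remark after Definition
  2.8.1 (p. 30), whose direction "⇐" is `AreSmoothEquivalent.of_isSmoothAt`.
* PROVED: `Stacks05B5.isSmoothAt_comap` — the pointwise form actually used (if `D` is
  smooth over a finitely presented `Λ`-algebra `A` and `D` is `Λ`-smooth at a prime `r`, then
  `A` is `Λ`-smooth at `r ∩ A`), from the fact by Chevalley's openness of flat finitely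
  presented maps (`PrimeSpectrum.isOpenMap_comap_of_hasGoingDown_of_finitePresentation`) and
  `Algebra.IsSmoothAt.exists_notMem_smooth`; the `AreSmoothEquivalent` API
  `of_smooth_right`/`of_smooth_left` (shrinking either side along a smooth map, e.g. the open
  immersion `Spec m° ⊂ Nr_m(S)` of Step 3, p. 49: "Recall that `Sᵢ` is open in `Nr_{mᵢ}(S)`")
  and `isSmoothAt_left'`/`isSmoothAt_left` (smooth-equivalent, compatibly with `Λ`-structures,
  to a `Λ`-smooth point ⇒ `Λ`-smooth, from `Stacks05B5`); the elementary API of `nrIn` (`Nr_K`) and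
  `etaModel`.

## Sources

* M. Temkin, *Inseparable local uniformization*, J. Algebra 373 (2013) 65–119 =
  arXiv:0804.1554v3: §2.3 (pp. 12–15: `Nr_B(A)`, `η`-normalization, Example 2.3.3, Definition
  2.3.6, Situation 2.3.7, Prop. 2.3.8, Lemma 2.3.9); §2.8 (pp. 29–31: Definition 2.8.1,
  Thm. 2.8.2, Lemmas 2.8.4, 2.8.5); §3.3, Lemma 3.3.2 and its proof (pp. 45–46); proof of
  Thm. 4.1.1, Steps 2–4 (pp. 48–49); §4.2, Step 2 (p. 51).
* The Stacks Project, Tag 05B5 (Descent, Lemma "smooth-permanence").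

## Rendering notes

* `Nr_K(T)` for a subring `T` of a field `K` is `nrIn T` (integral closure of `T` in `K`;
  §2.3, Example 2.3.3 (i)). For an affine integral `S_α = Spec B′`-scheme `Spec T`, `B′ ⊆ κ` with
  `Frac B′ = κ` and `T ⊆ K ⊇ κ`, the generic fibre is `Spec(T ⊗_{B′} κ) = Spec κ[T]` (a
  localization) and the `η`-normalization `Nr_η(Spec T)` (Example 2.3.3 (ii): "the spectrum of
  the integral closure of the image of `B` in `B_η`") is `Spec` of `Nr_K(T) ∩ κ[T]`; when the
  generic fibre `κ[C]` of the initial model is integrally closed in `K` (hypothesis of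
  `Temkin2013_Lemma284`, satisfied in §4 where the models are normal and the `Y`-side generic
  fibre is a field) this is `Nr_K(T)` itself, and the `η`-normalized base change
  `Nr_η(Spec C ×_{Spec B₀} Spec B′)` is `etaModel C B′ = Nr_K(C·B′)` (the image of `C ⊗ B′` in
  `κ[C]` is the subring generated by `C` and `B′`).
* Points are prime ideals; "the image of `x ∈ X` in `X_α`" is the contraction along
  `X_α ⊆ X` (`Ideal.comap (Subring.inclusion _)`); structure morphisms to affine bases are the
  ring maps `etaModelBaseMap` / `codRestrict`s of `algebraMap`, as in `Temkin2013RelativeCurve`.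
* Lemma 3.3.2 is vendored with `X′` an affine NORMALIZED `S`-scheme (`IsAffineNormalizedModel ⊤`):
  the printed statement says "affine nft `S`-scheme `X′`", the printed proof constructs
  "`X′ = Nr(Spec(A[f/π]))`" (p. 46), and §4.2, Step 2 uses it in this normalized form ("there
  exists an affine refinement `X′ → X` which induces `f_S` in the sense that
  `X′_S →~ Nr_K(X′ ×_Y S)`", p. 51). As for Thm. 3.3.1 the base is taken EQUICHARACTERISTIC of
  height one (§3, p. 31 and §3.3, p. 44: "Throughout this section `k` is a valued field of height
  1 and positive characteristic `p`"), which is how §4.2 applies it (`k = k̄ ⊇` the trivially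
  valued ground field; `ringChar_residueField_eq_of_algebraMap_mem`).
* Numbering in the earlier arXiv version held in the literature store (41 pp.): §2.8 is §2.7
  there (Definition 2.7.1 and Thm. 2.7.2 on p. 18, Lemmas 2.7.4/2.7.5 on p. 19), Situation 2.3.7,
  Prop. 2.3.8 and Lemma 2.3.9 are Situation 2.2.7 (p. 8), Prop. 2.2.8 and Lemma 2.2.9 (p. 9)
  there, and Lemma 3.3.2 keeps its number (p. 28 there; its `X` is "an affine integral
  `S`-scheme of normalized finite presentation" and its `X′` "an affine `S`-scheme … of
  normalized finite presentation").
-/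

noncomputable section

open IsLocalRing

namespace Literature.AlgebraicGeometry.Resolution

universe u

/-! ### `AreSmoothEquivalent`: shrinking along smooth maps -/

namespace AreSmoothEquivalent

variable {R₀ A B B' : Type u} [CommRing R₀] [CommRing A] [CommRing B] [CommRing B']

/-- If `(X, x)` is smooth-equivalent over `S` to `(Y′, y′)` and `Y′ → Y` is a smooth
`S`-morphism (e.g. an open immersion), then `(X, x)` is smooth-equivalent over `S` to
`(Y, image of y′)`: compose the smooth morphism `Z → Y′` with `Y′ → Y`. Affine: `B → B′` smooth,
structure map of `B′` factoring through `B`. [folklore] -/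
theorem of_smooth_right {f : R₀ →+* A} {g : R₀ →+* B} [Algebra B B'] [Algebra.Smooth B B']
    {p : Ideal A} {q' : Ideal B'}
    (h : AreSmoothEquivalent f ((algebraMap B B').comp g) p q') :
    AreSmoothEquivalent f g p (q'.comap (algebraMap B B')) := by
  obtain ⟨D, _, _, _, hcomp, hA, hB', r, hr, hrp, hrq⟩ := h
  letI : Algebra B D := ((algebraMap B' D).comp (algebraMap B B')).toAlgebra
  haveI : IsScalarTower B B' D := IsScalarTower.of_algebraMap_eq (fun _ => rfl)
  refine ⟨D, inferInstance, ‹Algebra A D›, inferInstance, ?_, hA, Algebra.Smooth.comp B B' D,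
    r, hr, hrp, ?_⟩
  · rw [hcomp]; rfl
  · rw [RingHom.algebraMap_toAlgebra, ← Ideal.comap_comap, hrq]

/-- Symmetric form of `of_smooth_right`. [folklore] -/
theorem of_smooth_left {f : R₀ →+* B} {g : R₀ →+* A} [Algebra B B'] [Algebra.Smooth B B']
    {p' : Ideal B'} {q : Ideal A}
    (h : AreSmoothEquivalent ((algebraMap B B').comp f) g p' q) :
    AreSmoothEquivalent f g (p'.comap (algebraMap B B')) q :=
  (of_smooth_right h.symm).symm

end AreSmoothEquivalent

/-! ### Descent of smoothness through flat covers (Stacks Project, Tag 05B5) -/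

/-- NAMED FACT — **smoothness descends through a surjective flat morphism of finite
presentation** (The Stacks Project, Tag 05B5: "Let `X → Y → S` [`f : X → Y`, `p : X → S`,
`q : Y → S`] be a commutative diagram of morphisms of schemes. Assume that (1) `f` is surjective,
flat, and locally of finite presentation, (2) `p` is smooth (resp. étale). Then `q` is smooth
(resp. étale)."), the smooth case for affine schemes: for ring maps `Λ → R → S` with `S`
faithfully flat (flat and surjective on spectra) and of finite presentation over `R`, if `S` is
smooth over `Λ` then `R` is smooth over `Λ`. Mathlib has descent of smoothness along faithfully
flat BASE change (`Algebra.Smooth.of_smooth_tensorProduct_of_faithfullyFlat`), not this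
permanence through a cover of the source. Users take `(h : Stacks05B5)`.
[cite: StacksProject, Tag 05B5] -/
def Stacks05B5 : Prop :=
  ∀ (Λ R S : Type u) [CommRing Λ] [CommRing R] [CommRing S] [Algebra Λ R] [Algebra Λ S]
    [Algebra R S] [IsScalarTower Λ R S],
    Module.FaithfullyFlat R S → Algebra.FinitePresentation R S → Algebra.Smooth Λ S →
      Algebra.Smooth Λ R

/-- **Pointwise descent of smoothness along a smooth morphism** (the form of Tag 05B5 used in
Temkin 2013, proof of Thm. 4.1.1, Step 4, p. 49: "`xᵢ` are still smooth-equivalent to `yᵢ` …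
In particular, `x₁` is `l`-smooth"): if `A` is a finitely presented `Λ`-algebra, `D` a smooth
`A`-algebra and `r ⊂ D` a prime at which `D` is `Λ`-smooth, then `A` is `Λ`-smooth at `r ∩ A`.
Proof: `D_g` is `Λ`-smooth for some `g ∉ r`; the image of `Spec D_g → Spec A` is open
(Chevalley: flat and finitely presented) and contains `p = r ∩ A`, so contains a basic open
`D(a) ∋ p`; then `A_a → (D_g)_a` is faithfully flat of finite presentation with `Λ`-smooth
source, so `A_a` is `Λ`-smooth by Tag 05B5, whence `A` is `Λ`-smooth at `p`. PROVED from the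
fact. [cite: StacksProject, Tag 05B5] -/
theorem Stacks05B5.isSmoothAt_comap (h05 : Stacks05B5.{u}) {Λ A D : Type u}
    [CommRing Λ] [CommRing A] [CommRing D] [Algebra Λ A] [Algebra A D] [Algebra Λ D]
    [IsScalarTower Λ A D] [Algebra.FinitePresentation Λ A] [Algebra.Smooth A D]
    (r : Ideal D) [r.IsPrime] [Algebra.IsSmoothAt Λ r] :
    Algebra.IsSmoothAt Λ (r.comap (algebraMap A D)) := by
  classical
  haveI : Algebra.FinitePresentation Λ D := .trans Λ A D
  -- Step 1: `D_g` is `Λ`-smooth for some `g ∉ r`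
  obtain ⟨g, hgr, hDg⟩ := Algebra.IsSmoothAt.exists_notMem_smooth Λ r
  let Dg := Localization.Away g
  haveI : Algebra.Smooth D Dg := .of_isLocalization_Away g
  haveI : Algebra.Smooth A Dg := .comp A D Dg
  haveI : Algebra.Smooth Λ Dg := hDg
  -- the prime `r D_g` lies over `p = r ∩ A`
  have hdisj : Disjoint (↑(Submonoid.powers g) : Set D) ↑r := by
    refine Set.disjoint_left.mpr ?_
    rintro x ⟨n, rfl⟩ hx
    exact hgr (‹r.IsPrime›.mem_of_pow_mem n hx)
  let rg : Ideal Dg := r.map (algebraMap D Dg)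
  haveI hrg : rg.IsPrime := IsLocalization.isPrime_of_isPrime_disjoint (Submonoid.powers g) Dg r
    ‹r.IsPrime› hdisj
  have hrg_comap : rg.comap (algebraMap D Dg) = r :=
    IsLocalization.under_map_of_isPrime_disjoint (Submonoid.powers g) Dg ‹r.IsPrime› hdisj
  -- Step 2: the image of `Spec D_g → Spec A` is open and contains `p`
  have hopen : IsOpen (Set.range (PrimeSpectrum.comap (algebraMap A Dg))) :=
    (PrimeSpectrum.isOpenMap_comap_of_hasGoingDown_of_finitePresentation).isOpen_range
  have hpmem : (⟨r.comap (algebraMap A D), inferInstance⟩ : PrimeSpectrum A) ∈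
      Set.range (PrimeSpectrum.comap (algebraMap A Dg)) := by
    refine ⟨⟨rg, hrg⟩, PrimeSpectrum.ext ?_⟩
    change rg.comap (algebraMap A Dg) = r.comap (algebraMap A D)
    rw [IsScalarTower.algebraMap_eq A D Dg, ← Ideal.comap_comap, hrg_comap]
  -- Step 3: a basic open `D(a) ∋ p` inside the image
  obtain ⟨_, ⟨_, ⟨a, rfl⟩, rfl⟩, hpa, haU⟩ :=
    PrimeSpectrum.isBasis_basic_opens.exists_subset_of_mem_open hpmem hopen
  -- Step 4: `A_a → E = (D_g)_a` is faithfully flat of finite presentation, `E` is `Λ`-smooth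
  let Aa := Localization.Away a
  let a' : Dg := algebraMap A Dg a
  let E := Localization.Away a'
  haveI : Algebra.Smooth Dg E := .of_isLocalization_Away a'
  haveI : Algebra.Smooth Λ E := .comp Λ Dg E
  haveI : Algebra.Smooth A E := .comp A Dg E
  have hunit : ∀ y : Submonoid.powers a, IsUnit (algebraMap A E y) := by
    rintro ⟨_, n, rfl⟩
    rw [map_pow]
    refine IsUnit.pow n ?_
    rw [IsScalarTower.algebraMap_apply A Dg E]
    exact IsLocalization.Away.algebraMap_isUnit a'
  letI : Algebra Aa E := (IsLocalization.lift (M := Submonoid.powers a) (S := Aa) hunit).toAlgebra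
  haveI : IsScalarTower A Aa E :=
    IsScalarTower.of_algebraMap_eq (fun x => (IsLocalization.lift_eq hunit x).symm)
  haveI : IsScalarTower Λ Aa E := IsScalarTower.of_algebraMap_eq fun x => by
    change algebraMap Λ E x = algebraMap Aa E (algebraMap Λ Aa x)
    rw [IsScalarTower.algebraMap_apply Λ A Aa, ← IsScalarTower.algebraMap_apply A Aa E,
      IsScalarTower.algebraMap_apply Λ Dg E, IsScalarTower.algebraMap_apply Λ D Dg,
      IsScalarTower.algebraMap_apply Λ A D, ← IsScalarTower.algebraMap_apply A D Dg,
      ← IsScalarTower.algebraMap_apply A Dg E]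
  haveI : Module.Flat A E := inferInstance
  haveI : Module.Flat Aa E :=
    (Module.flat_iff_of_isLocalization (S := Aa) (p := Submonoid.powers a) (M := E)).mpr ‹_›
  haveI : Algebra.FinitePresentation A Aa := IsLocalization.Away.finitePresentation a
  haveI : Algebra.FinitePresentation Aa E :=
    Algebra.FinitePresentation.of_restrict_scalars_finitePresentation A Aa E
  -- surjectivity of `Spec E → Spec A_a`
  have hsurj : Function.Surjective (PrimeSpectrum.comap (algebraMap Aa E)) := by
    intro P
    let P₀ : Ideal A := P.asIdeal.comap (algebraMap A Aa)
    haveI : P₀.IsPrime := Ideal.comap_isPrime _ _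
    have haP₀ : a ∉ P₀ := fun ha =>
      P.2.ne_top (Ideal.eq_top_of_isUnit_mem _ ha (IsLocalization.Away.algebraMap_isUnit a))
    have hP₀mem : (⟨P₀, inferInstance⟩ : PrimeSpectrum A) ∈ (PrimeSpectrum.basicOpen a : Set _) :=
      haP₀
    obtain ⟨Q₀, hQ₀⟩ := haU hP₀mem
    have hQ₀' : Q₀.asIdeal.comap (algebraMap A Dg) = P₀ := congrArg PrimeSpectrum.asIdeal hQ₀
    have ha'Q₀ : a' ∉ Q₀.asIdeal := fun h' => haP₀ (by rw [← hQ₀']; exact h')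
    have hdisj' : Disjoint (↑(Submonoid.powers a') : Set Dg) ↑Q₀.asIdeal := by
      refine Set.disjoint_left.mpr ?_
      rintro x ⟨n, rfl⟩ hx
      exact ha'Q₀ (Q₀.2.mem_of_pow_mem n hx)
    let Q : Ideal E := Q₀.asIdeal.map (algebraMap Dg E)
    haveI hQ : Q.IsPrime :=
      IsLocalization.isPrime_of_isPrime_disjoint (Submonoid.powers a') E Q₀.asIdeal Q₀.2 hdisj'
    refine ⟨⟨Q, hQ⟩, PrimeSpectrum.ext ?_⟩
    change Q.comap (algebraMap Aa E) = P.asIdeal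
    have key : (Q.comap (algebraMap Aa E)).comap (algebraMap A Aa) = P₀ := by
      rw [Ideal.comap_comap, ← IsScalarTower.algebraMap_eq A Aa E,
        IsScalarTower.algebraMap_eq A Dg E, ← Ideal.comap_comap]
      change Ideal.comap (algebraMap A Dg) (Ideal.under Dg (Ideal.map (algebraMap Dg E) Q₀.asIdeal)) = P₀
      rw [IsLocalization.under_map_of_isPrime_disjoint (Submonoid.powers a') E Q₀.2 hdisj', hQ₀']
    rw [← IsLocalization.map_under (Submonoid.powers a) Aa (Q.comap (algebraMap Aa E)),
      Ideal.under_def, key]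
    exact IsLocalization.map_under (Submonoid.powers a) Aa P.asIdeal
  haveI : Module.FaithfullyFlat Aa E := .of_comap_surjective hsurj
  have hAa : Algebra.Smooth Λ Aa := h05 Λ Aa E ‹_› ‹_› ‹_›
  -- conclusion: `D(a) ⊆` smooth locus
  have hsub : ↑(PrimeSpectrum.basicOpen a) ⊆ Algebra.smoothLocus Λ A :=
    Algebra.basicOpen_subset_smoothLocus_iff.mpr hAa.formallySmooth
  exact hsub hpa

namespace AreSmoothEquivalent

variable {Λ R₀ A B : Type u} [CommRing Λ] [CommRing R₀] [CommRing A] [CommRing B]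

/-- **A point smooth-equivalent to a `Λ`-smooth point is `Λ`-smooth** (Temkin 2013, after
Definition 2.8.1, p. 30: "for a field `k` and a `k`-variety `X`, a point `x ∈ X` is
smooth-equivalent to `(Spec(k), Spec(k))` if and only if `X` is `k`-smooth at `x`", direction
"⇒", and proof of Thm. 4.1.1, Step 4, p. 49: "In particular, `x₁` is `l`-smooth"), general form:
`(X, x)` and `(Y, y)` smooth-equivalent over `S = Spec R₀`, `X = Spec A` and `Y = Spec B` finitely
presented over `Λ`, and the `Λ`-structures compatible in the sense that they induce the same
`Λ`-structure on every common smooth cover `Z = Spec D` over `S` (hypothesis `hΛ`; automatic when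
the structure maps are `Λ`-algebra maps, `isSmoothAt_left`, and — by reducedness of smooth
covers — when they agree on a subfield over which `Λ` is purely inseparable, the situation of
Step 4); then `Y` `Λ`-smooth at `y` implies `X` `Λ`-smooth at `x`: `Z` is `Λ`-smooth at `z`
(composition `Z → Y → Spec Λ`) and smoothness descends along the smooth morphism `Z → X`
(Tag 05B5, pointwise form `Stacks05B5.isSmoothAt_comap`). PROVED from `Stacks05B5`.
[cite: StacksProject, Tag 05B5] -/
theorem isSmoothAt_left' (h05 : Stacks05B5.{u}) [Algebra Λ A] [Algebra Λ B]
    [Algebra.FinitePresentation Λ A] [Algebra.FinitePresentation Λ B]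
    {f : R₀ →+* A} {g : R₀ →+* B} {p : Ideal A} {q : Ideal B} [p.IsPrime] [q.IsPrime]
    (h : AreSmoothEquivalent f g p q)
    (hΛ : ∀ (D : Type u) [CommRing D] [Algebra A D] [Algebra B D],
      (algebraMap A D).comp f = (algebraMap B D).comp g → Algebra.Smooth A D → Algebra.Smooth B D →
        (algebraMap A D).comp (algebraMap Λ A) = (algebraMap B D).comp (algebraMap Λ B))
    (hq : Algebra.IsSmoothAt Λ q) : Algebra.IsSmoothAt Λ p := by
  obtain ⟨D, _, _, _, hcomp, hA, hB, r, hr, hrp, hrq⟩ := h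
  -- the two `Λ`-structures on `D` (through `A` and through `B`) agree
  letI : Algebra Λ D := ((algebraMap A D).comp (algebraMap Λ A)).toAlgebra
  haveI : IsScalarTower Λ A D := IsScalarTower.of_algebraMap_eq (fun _ => rfl)
  haveI : IsScalarTower Λ B D :=
    IsScalarTower.of_algebraMap_eq' (hΛ D hcomp hA hB)
  -- `D` is `Λ`-smooth at `r`: `B_q → D_r` is formally smooth, `B_q` is `Λ`-formally smooth
  haveI : Algebra.IsSmoothAt Λ r := by
    change Algebra.FormallySmooth Λ (Localization.AtPrime r)
    haveI hqr : r.LiesOver q := ⟨hrq.symm⟩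
    letI := Localization.AtPrime.algebraOfLiesOver q r
    haveI : Algebra.FormallySmooth B (Localization.AtPrime r) := inferInstance
    haveI : Algebra.FormallySmooth (Localization.AtPrime q) (Localization.AtPrime r) :=
      Algebra.FormallySmooth.localization_base (Rₘ := Localization.AtPrime q)
        (Sₘ := Localization.AtPrime r) q.primeCompl
    haveI : Algebra.FormallySmooth Λ (Localization.AtPrime q) := hq
    exact .comp Λ (Localization.AtPrime q) (Localization.AtPrime r)
  subst hrp
  exact h05.isSmoothAt_comap (Λ := Λ) (A := A) r

/-- `isSmoothAt_left'` for `Λ`-algebras `R₀ → A`, `R₀ → B`: smooth-equivalent over `S` to a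
`Λ`-smooth point ⇒ `Λ`-smooth. PROVED from `Stacks05B5`. [cite: StacksProject, Tag 05B5] -/
theorem isSmoothAt_left (h05 : Stacks05B5.{u}) [Algebra Λ R₀] [Algebra Λ A] [Algebra Λ B]
    [Algebra.FinitePresentation Λ A] [Algebra.FinitePresentation Λ B]
    {f : R₀ →ₐ[Λ] A} {g : R₀ →ₐ[Λ] B} {p : Ideal A} {q : Ideal B} [p.IsPrime] [q.IsPrime]
    (h : AreSmoothEquivalent (f : R₀ →+* A) (g : R₀ →+* B) p q) (hq : Algebra.IsSmoothAt Λ q) :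
    Algebra.IsSmoothAt Λ p := by
  refine isSmoothAt_left' h05 h (fun D _ _ _ hcomp _ _ => ?_) hq
  ext c
  have hf : algebraMap Λ A c = f (algebraMap Λ R₀ c) := (f.commutes c).symm
  have hg : algebraMap Λ B c = g (algebraMap Λ R₀ c) := (g.commutes c).symm
  rw [RingHom.comp_apply, RingHom.comp_apply, hf, hg]
  exact congrArg (fun φ : R₀ →+* D => φ (algebraMap Λ R₀ c)) hcomp

end AreSmoothEquivalent

/-! ### `Nr_K` and `η`-normalized affine models inside a field (§2.3) -/

section etaModels

variable {κ K : Type u} [Field κ] [Field K] [Algebra κ K]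

/-- `Nr_K(T)` — the `K`-normalization of the affine `K`-pointed scheme `Spec T` for a subring
`T ⊆ K` (Temkin 2013, §2.3, p. 13: "If `Y = Spec(B)` and `X = Spec(A)` then we define `Nr_B(A)`
to be the integral closure of the image of `A` in `B`"; Example 2.3.3 (i): `Nr_K`): the integral
closure of `T` in `K`, as a subring of `K`. [cite: Temkin2013, Section 2.3 (p. 13)] -/
def nrIn (T : Subring K) : Subring K :=
  (integralClosure T K).toSubring

/-- Membership in `Nr_K(T)` is integrality over `T`. [folklore] -/
theorem mem_nrIn_iff {T : Subring K} {x : K} : x ∈ nrIn T ↔ IsIntegral T x := Iff.rfl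

/-- `T ⊆ Nr_K(T)`. [folklore] -/
theorem le_nrIn (T : Subring K) : T ≤ nrIn T := fun x hx =>
  mem_nrIn_iff.mpr (isIntegral_algebraMap (R := T) (x := ⟨x, hx⟩))

/-- `Nr_K` is monotone. [folklore] -/
theorem nrIn_mono {T T' : Subring K} (h : T ≤ T') : nrIn T ≤ nrIn T' := fun x hx => by
  letI : Algebra T T' := (Subring.inclusion h).toAlgebra
  haveI : IsScalarTower T T' K := IsScalarTower.of_algebraMap_eq (fun _ => rfl)
  exact mem_nrIn_iff.mpr (mem_nrIn_iff.mp hx).tower_top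

/-- `Nr_K` is idempotent: `Nr_K(Nr_K(T)) = Nr_K(T)` (transitivity of integrality). [folklore] -/
theorem nrIn_nrIn (T : Subring K) : nrIn (nrIn T) = nrIn T := by
  refine le_antisymm (fun x hx => ?_) (le_nrIn (nrIn T))
  letI : Algebra T (nrIn T) := (Subring.inclusion (le_nrIn T)).toAlgebra
  haveI : IsScalarTower T (nrIn T) K := IsScalarTower.of_algebraMap_eq (fun _ => rfl)
  haveI : Algebra.IsIntegral T (nrIn T) :=
    ⟨fun y => (isIntegral_algHom_iff (IsScalarTower.toAlgHom T (nrIn T) K)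
      Subtype.val_injective).mp (mem_nrIn_iff.mp y.2)⟩
  exact mem_nrIn_iff.mpr (isIntegral_trans (A := nrIn T) x (mem_nrIn_iff.mp hx))

variable (κ) in
/-- The **`η`-normalized affine model at level `B′`**: for an affine model `Spec C`, `C ⊆ K`,
over an affine base inside `κ` and a further base ring `B′ ⊆ κ` (an affine refinement `Spec B′`
of the base, or the limit valuation ring `R₀`), the subring `Nr_K(C·B′)` of `K` — the ring of
the `η`-normalized base change `Nr_η(Spec C ×_{Spec B₀} Spec B′)` (Temkin 2013, Definition
2.3.6 and Situation 2.3.7: "We define `X_α`, `Y_α` and `f_α` (resp. `X`, `Y` and `f`) to be the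
`η`-normalized base changes of `X₀`, `Y₀` and `f₀` with respect to the morphism `S_α → S₀`
(resp. `S → S₀`)") whenever the generic fibre `κ[C]` is integrally closed in `K` (see the
module docstring; in §4: `X_α = Nr_η(X ×_Y Y_α) = Nr_K(A·B_α)`, p. 48: "Note that
`Xα := Nr_η(X ×_Y Y_α)` is a normalized `k`-model of `K°` which refines `X`").
[cite: Temkin2013, Definition 2.3.6 and Situation 2.3.7] -/
def etaModel (C : Subring K) (B' : Subring κ) : Subring K :=
  nrIn (C ⊔ B'.map (algebraMap κ K))

/-- An `η`-model contains the model: `C ⊆ Nr_K(C·B′)`. [folklore] -/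
theorem le_etaModel (C : Subring K) (B' : Subring κ) : C ≤ etaModel κ C B' :=
  (le_sup_left (b := B'.map (algebraMap κ K))).trans (le_nrIn _)

/-- An `η`-model contains (the image of) its base ring: `B′ ⊆ Nr_K(C·B′)`. [folklore] -/
theorem map_le_etaModel (C : Subring K) (B' : Subring κ) :
    B'.map (algebraMap κ K) ≤ etaModel κ C B' :=
  (le_sup_right (a := C)).trans (le_nrIn _)

/-- `η`-models grow with the base ring (the refinement `X_β → X_α` for `α ≤ β`, and `X → X_α`).
[folklore] -/
theorem etaModel_mono (C : Subring K) {B₁ B₂ : Subring κ} (h : B₁ ≤ B₂) :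
    etaModel κ C B₁ ≤ etaModel κ C B₂ :=
  nrIn_mono (sup_le_sup_left (fun _ ⟨y, hy, e⟩ => ⟨y, h hy, e⟩) C)

/-- The structure morphism `X_{B′} → Spec B′` of an `η`-normalized affine model: the ring map
`B′ → Nr_K(C·B′)`. [folklore] -/
def etaModelBaseMap (C : Subring K) (B' : Subring κ) : B' →+* etaModel κ C B' :=
  ((algebraMap κ K).comp B'.subtype).codRestrict (etaModel κ C B')
    fun b => map_le_etaModel C B' ⟨b, b.2, rfl⟩

/-- The base map of an `η`-model is the restriction of `κ → K`. [folklore] -/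
@[simp] theorem etaModelBaseMap_apply (C : Subring K) (B' : Subring κ) (b : B') :
    (etaModelBaseMap C B' b : K) = algebraMap κ K b := rfl

end etaModels

/-! ### Lemma 2.8.4 (direction "⇒") -/

/-- NAMED FACT — **smooth-equivalence descends from `η`-normalized filtered projective limits**
(Temkin 2013, Lemma 2.8.4, p. 31: "Keep the notation of Situation 2.3.7. Assume that `x ∈ X` and
`y ∈ Y` are points and let `x_α` and `y_α` be their images in `X_α` and `Y_α`, respectively. Then
`(X, x)` and `(Y, y)` are smooth-equivalent over `S` if and only if there exists `α₀ ∈ A` such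
that for each `α ≥ α₀` the germs `(X_α, x_α)` and `(Y_α, y_α)` are smooth-equivalent over `S_α`";
Situation 2.3.7, p. 14: "Let `{S_α}_{α ∈ A}` be a filtered projective family of integral qcqs
schemes with dominant affine transition morphisms and an initial scheme `S₀`. The scheme
`S = proj lim S_α` exists … Let, furthermore, `X₀` and `Y₀` be the `η₀`-normalizations of
`S₀`-schemes `X̄₀` and `Ȳ₀` of finite presentation … We define `X_α`, `Y_α` and `f_α` (resp. `X`,
`Y` and `f`) to be the `η`-normalized base changes of `X₀`, `Y₀` and `f₀` with respect to the
morphism `S_α → S₀` (resp. `S → S₀`)"), direction "⇒", vendored in the affine situation of its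
use in §4 (proof of Thm. 4.1.1, Step 3, p. 49; §4.2, Step 2, p. 51): `S_α = Spec B_α` for a
directed family of Noetherian subrings `B_α` of a field `κ`, all with fraction field `κ` and
containing the initial `B_{α₀}` (the affine refinements `Y_α` of `Y = Spec B_{α₀}`), `S = Spec R₀`
with `R₀ = ⋃ B_α` (`S →~ proj lim Y_α`); `X̄₀ = Spec C` with `C ⊆ K ⊇ κ` finitely generated over
`B_{α₀}` and generic fibre `κ[C]` integrally closed in `K`, so that `X_α = Spec Nr_K(C·B_α)` and
`X = Spec Nr_K(C·R₀)` (`etaModel`); likewise `Ȳ₀ = Spec C′`, `C′ ⊆ M ⊇ κ`. Conclusion: if the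
primes `x ⊂ Nr_K(C·R₀)` and `y ⊂ Nr_M(C′·R₀)` are smooth-equivalent over `R₀`, then for all
large `α` their contractions to `Nr_K(C·B_α)` and `Nr_M(C′·B_α)` are smooth-equivalent over
`B_α`. The printed proof rests on Prop. 2.3.8 (`η`-normalized version of EGA IV₃ §8: limits,
morphisms and smoothness descend to a finite level); not reproduced here. DISCHARGED:
`Temkin2013_Lemma284_holds` (`InseparableLocalUniformizationLemmasProofs.lean`); users of
`(h : Temkin2013_Lemma284)` are fed that theorem. [cite: Temkin2013, Lemma 2.8.4 (with Situation 2.3.7)] -/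
def Temkin2013_Lemma284 : Prop :=
  ∀ (ι : Type u) [Preorder ι] [IsDirected ι (· ≤ ·)] (α₀ : ι), (∀ α, α₀ ≤ α) →
  ∀ (κ K M : Type u) [Field κ] [Field K] [Field M] [Algebra κ K] [Algebra κ M]
    (B : ι → Subring κ), Monotone B → IsNoetherianRing (B α₀) →
    (∀ α, ∀ z : κ, ∃ a ∈ B α, ∃ b ∈ B α, z = a / b) →
  ∀ (R₀ : Subring κ) (hB : ∀ α, B α ≤ R₀), (∀ r ∈ R₀, ∃ α, r ∈ B α) →
  ∀ (C : Subring K) (s : Finset K),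
    C = Subring.closure (↑((B α₀).map (algebraMap κ K)) ∪ ↑s) →
    (∀ z : K, IsIntegral (Algebra.adjoin κ (C : Set K)) z → z ∈ Algebra.adjoin κ (C : Set K)) →
  ∀ (C' : Subring M) (s' : Finset M),
    C' = Subring.closure (↑((B α₀).map (algebraMap κ M)) ∪ ↑s') →
    (∀ z : M, IsIntegral (Algebra.adjoin κ (C' : Set M)) z → z ∈ Algebra.adjoin κ (C' : Set M)) →
  ∀ (x : Ideal (etaModel κ C R₀)) (y : Ideal (etaModel κ C' R₀)), x.IsPrime → y.IsPrime →
    AreSmoothEquivalent (etaModelBaseMap C R₀) (etaModelBaseMap C' R₀) x y →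
    ∃ α₁ : ι, ∀ α, α₁ ≤ α →
      AreSmoothEquivalent (etaModelBaseMap C (B α)) (etaModelBaseMap C' (B α))
        (x.comap (Subring.inclusion (etaModel_mono C (hB α))))
        (y.comap (Subring.inclusion (etaModel_mono C' (hB α))))

/-! ### Lemma 2.8.5 (deprecated rendering; see `Temkin2013_Lemma285_normal` downstream) -/

/-- **Deprecated** (2026-08-15) — **mis-rendered named fact, REFUTED in tree**; superseded by
`Temkin2013_Lemma285_normal` (`SmoothEquivalenceNormalization.lean`, same namespace, declared
downstream of this file), which is this statement with `X = Spec A` and `Y = Spec B` NORMAL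
(`IsIntegrallyClosed A`, `IsIntegrallyClosed B` added) and which is PROVED there
(`Temkin2013_Lemma285_normal_holds`, `SmoothEquivalenceNormalizationProofs.lean`).
*What is wrong:* Temkin 2013, Lemma 2.8.5 (arXiv:0804.1554v3 p. 31; = Lemma 2.7.5, p. 19 of the
41-page arXiv version held in the literature store): "Let `X → S` and `Y → S` be dominant
morphisms between integral schemes and let `x ∈ X`, `y ∈ Y` be points which are
smooth-equivalent over `S`. Assume that `k′/k(S)` is a finite purely inseparable extension and
set `X′ = Nr_{k′k(X)}(X)` and `Y′ = Nr_{k′k(Y)}(Y)`. Then the preimages `x′ ∈ X′` and `y′ ∈ Y′`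
of `x` and `y` are smooth-equivalent over `S`." The printed "the preimages" presupposes that
`X′ → X` and `Y′ → Y` are bijective (printed proof: "The morphisms `X′ → X`, `Y′ → Y` and `Z′ → Z`
are bijective, hence we should only check that the induced morphisms `f′ : Z′ → X′` and
`Z′ → Y′` are smooth. But the latter was proved in Lemma 2.3.9 (ii)."), which is where normality
of `X`, `Y` is tacitly used — and available at every application (proof of Thm. 4.1.1, Step 4,
p. 49: `X_{i,α} = Nr_{Kᵢ}(X_α)`, `Y_{i,α} = Nr_{mᵢ}(Y_α)`; §4.2, Step 2, p. 51). This rendering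
assumes `X`, `Y` merely integral and quantifies over ALL primes `x′`, `y′` of the integral
closures lying over `x`, `y`; so read it is FALSE: for the affine line with two points glued,
`X = Y = S`, `k′ = k(S)`, the two preimages of the singular point in the normalization are not
smooth-equivalent over `S`. Refuted in tree: `not_temkin2013_Lemma285 : ¬ Temkin2013_Lemma285`
(`SmoothEquivalenceNormalization.lean`). Kept verbatim (statement unchanged) as the literal
record and as the subject of its refutation (and of `Temkin2013_Lemma285_normal.of_lemma285`);
never use `(h : Temkin2013_Lemma285)` as a hypothesis (it is refutable, so anything follows) —
`Temkin2013_Steps34` and the §4 assembly take `Temkin2013_Lemma285_normal`.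
*Original content* — affine rendering: `S = Spec R₀` with `R₀` a domain with fraction field
`κ = k(S)`; `X = Spec A`, `Y = Spec B` domains with fraction fields `K`, `M`, dominant over `S`
(injective structure maps); `k′ ⊇ κ` finite purely inseparable; `K′ = k′K ⊇ K` and
`M′ = k′M ⊇ M` fields generated over `K`, resp. `M`, by (the image of) `k′`, all maps compatible
over `R₀`; `X′ = Spec Nr_{K′}(A)`, `Y′ = Spec Nr_{M′}(B)` (integral closures). Conclusion:
primes `x′`, `y′` of the integral closures lying over smooth-equivalent `x`, `y` are
smooth-equivalent over `R₀`. The printed proof rests on Lemma 2.3.9 (ii); not reproduced.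
[cite: Temkin2013, Lemma 2.8.5 (arXiv:0804.1554v3 p. 31) as rendered for integral X and Y — refuted in tree; corrected as Temkin2013_Lemma285_normal] -/
@[deprecated "mis-rendered (X, Y merely integral and all preimages x', y'; refuted by Literature.AlgebraicGeometry.Resolution.not_temkin2013_Lemma285): use Literature.AlgebraicGeometry.Resolution.Temkin2013_Lemma285_normal of SmoothEquivalenceNormalization.lean (proved: Temkin2013_Lemma285_normal_holds)" (since := "2026-08-15")]
def Temkin2013_Lemma285 : Prop :=
  ∀ (R₀ κ k' : Type u) [CommRing R₀] [IsDomain R₀] [Field κ] [Algebra R₀ κ] [IsFractionRing R₀ κ]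
    [Field k'] [Algebra κ k'] [Algebra R₀ k'] [IsScalarTower R₀ κ k'],
    FiniteDimensional κ k' → IsPurelyInseparable κ k' →
  ∀ (A K K' : Type u) [CommRing A] [IsDomain A] [Algebra R₀ A] [FaithfulSMul R₀ A]
    [Field K] [Algebra A K] [IsFractionRing A K] [Algebra R₀ K] [IsScalarTower R₀ A K]
    [Field K'] [Algebra K K'] [Algebra A K'] [IsScalarTower A K K']
    [Algebra k' K'] [Algebra R₀ K'] [IsScalarTower R₀ K K'] [IsScalarTower R₀ k' K']
    [IsScalarTower R₀ A K'],
    Algebra.adjoin K (Set.range (algebraMap k' K')) = ⊤ →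
  ∀ (B M M' : Type u) [CommRing B] [IsDomain B] [Algebra R₀ B] [FaithfulSMul R₀ B]
    [Field M] [Algebra B M] [IsFractionRing B M] [Algebra R₀ M] [IsScalarTower R₀ B M]
    [Field M'] [Algebra M M'] [Algebra B M'] [IsScalarTower B M M']
    [Algebra k' M'] [Algebra R₀ M'] [IsScalarTower R₀ M M'] [IsScalarTower R₀ k' M']
    [IsScalarTower R₀ B M'],
    Algebra.adjoin M (Set.range (algebraMap k' M')) = ⊤ →
  ∀ (x : Ideal A) (y : Ideal B), x.IsPrime → y.IsPrime →
    AreSmoothEquivalent (algebraMap R₀ A) (algebraMap R₀ B) x y →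
  ∀ (x' : Ideal (integralClosure A K')) (y' : Ideal (integralClosure B M')),
    x'.IsPrime → y'.IsPrime →
    x'.comap (algebraMap A (integralClosure A K')) = x →
    y'.comap (algebraMap B (integralClosure B M')) = y →
    AreSmoothEquivalent (algebraMap R₀ (integralClosure A K')) (algebraMap R₀ (integralClosure B M'))
      x' y'

/-! ### Lemma 3.3.2 (deprecated rendering; see `Temkin2013_Lemma332_nft` downstream) -/

section lemma332

variable {k K m : Type u} [Field k] [Field K] [Field m] [Algebra k K] [Algebra k m]

/-- For a subring `A′ ⊆ k[A] ⊆ K` of the generic fibre and a `k`-algebra map `φ : k[A] → m`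
(the closed point `x`, `m = k(x)`) taking `A′` into a valuation ring `m°` of `m`: the induced
ring map `A′ → m°`, i.e. the morphism `i′ : S_m = Spec m° → X′ = Spec A′` of Lemma 3.3.2.
[folklore] -/
def liftToValuationSubring (S : Subalgebra k K) (φ : S →ₐ[k] m) (A' : Subring K)
    (hA' : ∀ a ∈ A', a ∈ S) (Om : ValuationSubring m) (h : ∀ a : A', φ ⟨a, hA' a a.2⟩ ∈ Om) :
    A' →+* Om :=
  ((φ : S →+* m).comp (A'.subtype.codRestrict S fun a => hA' a a.2)).codRestrict Om fun a => h a

/-- `liftToValuationSubring` is `φ` restricted to `A′`. [folklore] -/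
@[simp] theorem liftToValuationSubring_apply (S : Subalgebra k K) (φ : S →ₐ[k] m)
    (A' : Subring K) (hA' : ∀ a ∈ A', a ∈ S) (Om : ValuationSubring m)
    (h : ∀ a : A', φ ⟨a, hA' a a.2⟩ ∈ Om) (a : A') :
    (liftToValuationSubring S φ A' hA' Om h a : m) = φ ⟨a, hA' a a.2⟩ := rfl

end lemma332

/-- **Deprecated** (2026-08-15) — **mis-rendered named fact, REFUTED in tree**; superseded by
`Temkin2013_Lemma332_nft` (`InseparableLocalUniformizationDecompletion.lean`, same namespace,
declared downstream of this file), which is this statement with the printed finiteness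
hypothesis restored as `(⊤ : IntermediateField k K).FG` (one more hypothesis, after
`IsAffineNormalizedModel ⊤ … A`; `Temkin2013_Lemma332_nft.of_lemma332` there records the trivial
implication from this rendering).
*What is wrong:* Temkin 2013, Lemma 3.3.2 (arXiv:0804.1554v3 pp. 45–46; p. 28 of the 41-page
arXiv version held in the literature store, same number), with its setting: "`X = Spec(A)` is
an affine integral `S`-scheme of normalized finite presentation and `x ∈ X_η` is a closed point
of the generic fiber. Assume that the finite `k`-field `m = k(x)` is provided with a valuation
extending that of `k` and such that the closed immersion `i_x : Spec(m) → X_η` extends to a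
morphism `i : S_m → X`, where `S_m = Spec(m°)`. Lemma 3.3.2. Keep the above notation and assume
that `x` is a simple `k`-smooth point. Then there exists an affine `S`-scheme `X′` of
normalized finite presentation and a morphism `f : X′ → X` such that `f_η` is an isomorphism,
the closed immersion `i_x : Spec(m) → X′_η` extends to a lifting `i′ : S_m → X′` of `i`, and the
image of the closed point of `S_m` under `i′` is smooth-equivalent to the closed point of
`S_m`." Here "of normalized finite presentation" (held version, Definition 2.2.4 (i): "a
composition of a partial normalization `Y → Y₀` and a morphism `Y₀ → X` of finite
presentation", a partial normalization of `Y₀` living inside its sheaf of meromorphic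
functions, p. 7 there) forces `K = Frac A` to be a finitely generated extension of `k` (and
`m/k` to be finite). This rendering's hypothesis `IsAffineNormalizedModel ⊤ k° A` only says
`A = Nr_K(k°[f₁, …, f_n])`, `Frac A = K`, with `K` possibly an INFINITE algebraic extension of
`Frac k°[f]` (`X_η` not of finite type over `k`), and so read the statement is FALSE:
`not_temkin2013_Lemma332 : ¬ Temkin2013_Lemma332`
(`InseparableLocalUniformizationDecompletionRefutation.lean`; counterexample `k = ℚ(X)` with the
`X`-adic valuation, `K = Frac k[ℚ] = k(t^q : q ∈ ℚ)`, `A = Nr_K(k°[t, t⁻¹])`, `m = k`, `x` the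
augmentation point `t^q ↦ 1`; an arithmetic variant `k = 𝔽_p(t)`, `K = m = kˢᵉᵖ`, `A = Nr_K(k°)`
is sketched in the module docstring of `InseparableLocalUniformizationDecompletion.lean`). Kept
verbatim (statement unchanged) as the literal record and as the subject of its refutation;
never use `(h : Temkin2013_Lemma332)` as a hypothesis (it is refutable, so anything follows) —
the §4.2 reduction has the finiteness needed for the `_nft` form
(`relConclusion_of_normalForm_nft`, `InseparableLocalUniformizationHeightStepTwo.lean`;
`relHeightLE_succ_nft` and `Temkin2013HeightStepOfDescent.of_lemma332nft_steps34`,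
`InseparableLocalUniformizationHeightInduction.lean`), and the corollaries there still taking
`(h332 : Temkin2013_Lemma332)` are vacuous records.
*Original content* — standing assumptions of §3/§3.3: `k` a valued field of height one,
`S = Spec(k°)`, `η = Spec(k)`, equal characteristic (see the module docstring). Affine
rendering: `X = Spec A` with `A ⊆ K = Frac A` an affine normalized `k°`-scheme
(`IsAffineNormalizedModel ⊤ k° A`: `A = Nr_K(k°[f₁, …, f_n])`); the generic fibre is
`X_η = Spec k[A]`; the closed point `x` is a prime of `k[A]` which is the kernel of a surjective
`k`-algebra map `φ : k[A] → m` onto a field (`m = k(x)`); "simple `k`-smooth" is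
`Algebra.IsSmoothAt k x ∧ Algebra.IsSeparable k m`; the valuation on `m` is a valuation ring `m°`
over `k°`, and "`i_x` extends to `i : S_m → X`" is `φ(A) ⊆ m°`. Conclusion: a subring
`A ⊆ A′ ⊆ k[A]` (`f : X′ → X` with `f_η` an isomorphism) which is again an affine normalized
`k°`-scheme (the printed proof's `X′ = Nr(Spec(A[f/π]))`, p. 46 — the printed statement says
normalized finite presentation), with `φ(A′) ⊆ m°` (`i′` lifts `i`), such that the contraction
of `𝔪_{m°}` to `A′` (the image of the closed point of `S_m`) and `𝔪_{m°} ∈ Spec m°` are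
smooth-equivalent over `k°` (`AreSmoothEquivalent`, Definition 2.8.1; "smooth-equivalent" in
the lemma is over `S`, as its proof via Thm. 2.8.2 (ii) shows). The printed proof is
Berkovich-analytic; Mathlib has none of it.
[cite: Temkin2013, Lemma 3.3.2 (arXiv:0804.1554v3 pp. 45–46) as rendered without the normalized-finite-presentation hypothesis — refuted in tree; corrected as Temkin2013_Lemma332_nft] -/
@[deprecated "mis-rendered (omits the printed normalized-finite-presentation hypothesis; refuted by Literature.AlgebraicGeometry.Resolution.not_temkin2013_Lemma332): use Literature.AlgebraicGeometry.Resolution.Temkin2013_Lemma332_nft of InseparableLocalUniformizationDecompletion.lean" (since := "2026-08-15")]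
def Temkin2013_Lemma332 : Prop :=
  ∀ (k K : Type u) [Field k] [Field K] [Algebra k K] (Ok : ValuationSubring k),
    ringChar (IsLocalRing.ResidueField Ok) = ringChar k → ringKrullDim Ok = 1 →
  ∀ (A : Subring K), IsAffineNormalizedModel ⊤ (Ok.toSubring.map (algebraMap k K)) A →
  ∀ (m : Type u) [Field m] [Algebra k m] (φ : Algebra.adjoin k (A : Set K) →ₐ[k] m),
    Function.Surjective φ →
  ∀ (x : Ideal (Algebra.adjoin k (A : Set K))) [x.IsPrime],
    RingHom.ker (φ : Algebra.adjoin k (A : Set K) →+* m) = x →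
    Algebra.IsSmoothAt k x → Algebra.IsSeparable k m →
  ∀ (Om : ValuationSubring m), Om.comap (algebraMap k m) = Ok →
    (∀ a : A, φ ⟨a, Algebra.subset_adjoin a.2⟩ ∈ Om) →
    ∃ (A' : Subring K), A ≤ A' ∧ IsAffineNormalizedModel ⊤ (Ok.toSubring.map (algebraMap k K)) A' ∧
      ∃ (hA' : ∀ a ∈ A', a ∈ Algebra.adjoin k (A : Set K))
        (hi' : ∀ a : A', φ ⟨a, hA' a a.2⟩ ∈ Om)
        (hkA' : ∀ c : Ok, algebraMap k K c ∈ A') (hkm : ∀ c : Ok, algebraMap k m c ∈ Om),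
        AreSmoothEquivalent
          (((algebraMap k K).comp Ok.subtype).codRestrict A' hkA')
          (((algebraMap k m).comp Ok.subtype).codRestrict Om hkm)
          ((IsLocalRing.maximalIdeal Om).comap
            (liftToValuationSubring (Algebra.adjoin k (A : Set K)) φ A' hA' Om hi'))
          (IsLocalRing.maximalIdeal Om)

end Literature.AlgebraicGeometry.Resolution
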